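import Literature.Analysis.FluidPDE.StationaryLerayHopfLaw
import Literature.Analysis.FluidPDE.DoeringFoiasPowerProofs
import Literature.Analysis.FluidPDE.LerayHopfGeneralizedEnergyIneq
import Literature.Analysis.FunctionSpaces.TorusFourierModes
import HarnessLib

/-!
# Measurability of the slice and unit-window functionals of a stationary Leray–Hopf law

Support file for the crux `LawRealisation` (routes `LoudWindows`, `LionsToll`; item
stmt-AnomalousDissipation-26823), closed in `Theorems/LoudWindowsLawRealisation.lean`. The structure
`Torus.IsStationaryLerayHopfLaw ν f P S traj` exposes measurability in `ω` ONLY through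
`measurable_pairing : ∀ t g, MemLp g 2 volume → Measurable fun ω => ∫ ⟪traj ω t, g⟫`; the item's named
formal risk was to get from there to the measurability / integrability of the slice energy
`ω ↦ ‖traj ω 0‖₂²` and of the unit-window functionals `ω ↦ ∫₀¹ ‖traj ω‖₂²`, `ω ↦ ∫⁻_{(0,1)} ‖∇ traj ω‖₂²`.
This file does exactly that:

* every Fourier coefficient of a real slice is read through two REAL `L²`-pairings with the single real
  modes `Re (e_k • eᵢ)`, `Re (e_k • I eᵢ)` (`Torus.integral_inner_realPart_mFourier_smul`), so its squared
  modulus is a finite sum of squares of pairings (`enorm_sq_mFourierCoeff_eq_ofReal_sum`);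
* the pairings at the clamped time `t ∨ 0` are continuous in `t` along every path (weak `L²`-continuity of
  Leray–Hopf solutions on `(0, T]` with right limit at `0⁺` equal to the slice `traj ω 0`) and measurable in
  `ω`, hence JOINTLY measurable on `ℝ × Ω` (Carathéodory, `measurable_uncurry_of_continuous_of_measurable`);
* slice energy (Parseval, `Torus.tsum_enorm_sq_mFourierCoeff_complexify`) and spectral dissipation
  (`Torus.eGradNormSq_eq_tsum`) are countable sums of squared moduli, hence jointly measurable, and the
  window functionals are measurable by Tonelli (`Measurable.lintegral_prod_left'`,
  `StronglyMeasurable.integral_prod_left'`).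

Decomposition cell `decomp-ad`, lens-3 lineage g61 (node ErgodicDictionary g3; the law-format dictionary).

[folklore] [cite: FoiasManleyRosaTemam2001, Ch. IV §3] [cite: FoiasRosaTemam2010, Def. 3.2]
-/

open MeasureTheory Filter Topology Set Function UnitAddTorus
open scoped ENNReal NNReal RealInnerProductSpace

noncomputable section

-- `Summit.<Summit>.<Problem>` repeats the summit = sub-problem segment (D-0017); line added at landing (census g17, writer NIT l.2012)
set_option linter.dupNamespace false

namespace Summit.AnomalousDissipation.AnomalousDissipation.Theorems

open Literature.Analysis.FunctionSpaces Literature.Analysis.FunctionSpaces.Torus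
open Literature.Analysis.FluidPDE

namespace LawRealisation

/-! ### Fourier coefficients of a real field through real `L²`-pairings -/

section Fourier

/-- The single real mode `x ↦ Re (e_k(x) • z)` is continuous. [folklore] -/
theorem continuous_realMode (k : Fin 3 → ℤ) (z : EuclideanSpace ℂ (Fin 3)) :
    Continuous fun x : UnitAddTorus (Fin 3) => EuclideanSpace.realPart (mFourier k x • z) :=
  EuclideanSpace.realPart.continuous.comp ((mFourier k).continuous.smul continuous_const)

/-- The single real mode `x ↦ Re (e_k(x) • z)` lies in `L²(T³; ℝ³)`. [folklore] -/
theorem memLp_realMode (k : Fin 3 → ℤ) (z : EuclideanSpace ℂ (Fin 3)) :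
    MemLp (fun x : UnitAddTorus (Fin 3) => EuclideanSpace.realPart (mFourier k x • z)) 2 volume := by
  refine MemLp.of_bound (continuous_realMode k z).aestronglyMeasurable ‖z‖
    (ae_of_all _ fun x => ?_)
  calc ‖EuclideanSpace.realPart (mFourier k x • z)‖ ≤ ‖mFourier k x • z‖ :=
        EuclideanSpace.norm_realPart_le _
    _ ≤ ‖mFourier k‖ * ‖z‖ := by
        rw [norm_smul]
        exact mul_le_mul_of_nonneg_right ((mFourier k).norm_coe_le_norm x) (norm_nonneg _)
    _ = ‖z‖ := by rw [mFourier_norm, one_mul]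

/-- `‖c‖² = ∑ᵢ (Re ⟪c, eᵢ⟫_ℂ)² + (Re ⟪c, I eᵢ⟫_ℂ)²` on `ℂ³` (`⟪c, a eᵢ⟫_ℂ = a · conj cᵢ`). [folklore] -/
theorem norm_sq_eq_sum_re_inner (c : EuclideanSpace ℂ (Fin 3)) :
    ‖c‖ ^ 2 = ∑ i, ((inner ℂ c (EuclideanSpace.single i (1 : ℂ))).re ^ 2 +
      (inner ℂ c (EuclideanSpace.single i Complex.I)).re ^ 2) := by
  rw [EuclideanSpace.norm_sq_eq]
  refine Finset.sum_congr rfl fun i _ => ?_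
  rw [Complex.sq_norm, Complex.normSq_apply, EuclideanSpace.inner_single_right,
    EuclideanSpace.inner_single_right]
  simp only [one_mul, Complex.mul_re, Complex.conj_re, Complex.conj_im, Complex.I_re,
    Complex.I_im, zero_mul, one_mul, zero_sub, neg_neg]
  ring

/-- For an integrable real field `w` on `T³`, the squared modulus of the `k`-th Fourier coefficient of
its complexification is a finite sum of squares of REAL `L²`-PAIRINGS of `w` with the single real
modes `Re (e_k • eᵢ)`, `Re (e_k • I eᵢ)` (`Torus.integral_inner_realPart_mFourier_smul`). [folklore] -/
theorem enorm_sq_mFourierCoeff_eq_ofReal_sum {w : UnitAddTorus (Fin 3) → EuclideanSpace ℝ (Fin 3)}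
    (hw : Integrable w volume)
    (k : Fin 3 → ℤ) :
    ‖mFourierCoeff (EuclideanSpace.complexify ∘ w) k‖ₑ ^ 2 =
      ENNReal.ofReal (∑ i,
        ((∫ x, ⟪w x, EuclideanSpace.realPart (mFourier k x • EuclideanSpace.single i (1 : ℂ))⟫) ^ 2 +
          (∫ x, ⟪w x, EuclideanSpace.realPart (mFourier k x • EuclideanSpace.single i Complex.I)⟫) ^ 2)) := by
  rw [← ofReal_norm, ← ENNReal.ofReal_pow (norm_nonneg _), norm_sq_eq_sum_re_inner]
  congr 1
  refine Finset.sum_congr rfl fun i _ => ?_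
  rw [integral_inner_realPart_mFourier_smul hw, integral_inner_realPart_mFourier_smul hw]

end Fourier

/-! ### The Bochner and the spectral unit-window dissipation along one Leray–Hopf path -/

section Path

variable {ν : ℝ} {f u₀ : UnitAddTorus (Fin 3) → EuclideanSpace ℝ (Fin 3)}
  {u : ℝ → UnitAddTorus (Fin 3) → EuclideanSpace ℝ (Fin 3)}

/-- Along a global Leray–Hopf solution the Bochner unit-window dissipation is the `toReal` of the
spectral `ℝ≥0∞` one: `∫₀¹ ν (‖∇u‖₂²).toReal = ν (∫⁻_{(0,1)} ‖∇u‖₂²).toReal`. [folklore] -/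
theorem windowDissipation_eq (hu : Torus.IsGlobalLerayHopf ν (fun _ => f) u₀ u) :
    ∫ t in (0 : ℝ)..1, ν * (eGradNormSq (u t)).toReal =
      ν * (∫⁻ s in Ioo (0 : ℝ) 1, eGradNormSq (u s)).toReal := by
  rw [intervalIntegral.integral_const_mul, intervalIntegral.integral_of_le zero_le_one,
    (hu.setIntegral_toReal_eGradNormSq (s := 0) (t := 1) le_rfl).2]

end Path

/-! ### Measurability of the slice and window functionals under a stationary Leray–Hopf law -/

section Law

variable {ν : ℝ} {f : UnitAddTorus (Fin 3) → EuclideanSpace ℝ (Fin 3)} {Ω : Type*} [MeasurableSpace Ω]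
  {P : Measure Ω} {S : Ω → Ω} {traj : Ω → ℝ → UnitAddTorus (Fin 3) → EuclideanSpace ℝ (Fin 3)}

/-- **Joint measurability of the clamped pairings.** For `g ∈ L²`, `(t, ω) ↦ ∫ ⟪traj ω (t ∨ 0), g⟫`
is measurable on `ℝ × Ω`: measurable in `ω` at each time (`measurable_pairing`) and continuous in
`t` along each path (weak `L²`-continuity of the Leray–Hopf path on `(0, T]`, right limit at `0⁺`
equal to the pairing of the slice `traj ω 0`, and constancy for `t ≤ 0`), hence jointly measurable
(Carathéodory). [folklore] -/
theorem measurable_pairing_clamp (h : Torus.IsStationaryLerayHopfLaw ν f P S traj)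
    {g : UnitAddTorus (Fin 3) → EuclideanSpace ℝ (Fin 3)} (hg : MemLp g 2 volume) :
    Measurable fun p : ℝ × Ω => ∫ x, ⟪traj p.2 (max p.1 0) x, g x⟫ := by
  have hcont : ∀ ω, Continuous fun t : ℝ => ∫ x, ⟪traj ω (max t 0) x, g x⟫ := by
    intro ω
    have hon : ContinuousOn (fun t : ℝ => ∫ x, ⟪traj ω t x, g x⟫) (Ici 0) := by
      intro t ht
      rcases (Set.mem_Ici.mp ht).eq_or_lt with h0 | hpos
      · subst h0
        exact continuousWithinAt_Ioi_iff_Ici.mp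
          ((h.isGlobalLerayHopf ω 1 one_pos).weak_continuous g hg).2
      · exact ((((h.isGlobalLerayHopf ω (t + 1) (by linarith)).weak_continuous g hg).1).continuousAt
          (Ioc_mem_nhds hpos (lt_add_one t))).continuousWithinAt
    exact hon.comp_continuous (continuous_id.max continuous_const) fun t => le_max_right t 0
  exact measurable_uncurry_of_continuous_of_measurable
    (u := fun (t : ℝ) (ω : Ω) => ∫ x, ⟪traj ω (max t 0) x, g x⟫) hcont
    fun t => h.measurable_pairing (max t 0) g hg

/-- Joint measurability of the squared moduli of the slice Fourier coefficients at clamped times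
(finite sums of squares of clamped pairings; every slice at a time `≥ 0` is integrable). [folklore] -/
theorem measurable_enorm_sq_mFourierCoeff_clamp (h : Torus.IsStationaryLerayHopfLaw ν f P S traj)
    (k : Fin 3 → ℤ) :
    Measurable fun p : ℝ × Ω =>
      ‖mFourierCoeff (EuclideanSpace.complexify ∘ traj p.2 (max p.1 0)) k‖ₑ ^ 2 := by
  have heq : (fun p : ℝ × Ω =>
      ‖mFourierCoeff (EuclideanSpace.complexify ∘ traj p.2 (max p.1 0)) k‖ₑ ^ 2) = fun p =>
      ENNReal.ofReal (∑ i,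
        ((∫ x, ⟪traj p.2 (max p.1 0) x,
            EuclideanSpace.realPart (mFourier k x • EuclideanSpace.single i (1 : ℂ))⟫) ^ 2 +
          (∫ x, ⟪traj p.2 (max p.1 0) x,
            EuclideanSpace.realPart (mFourier k x • EuclideanSpace.single i Complex.I)⟫) ^ 2)) :=
    funext fun p => enorm_sq_mFourierCoeff_eq_ofReal_sum
      (((h.isGlobalLerayHopf p.2).memLp_two (le_max_right p.1 0)).integrable one_le_two) k
  rw [heq]
  refine ENNReal.measurable_ofReal.comp (Finset.measurable_sum _ fun i _ => ?_)
  exact ((measurable_pairing_clamp h (memLp_realMode k _)).pow_const 2).add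
    ((measurable_pairing_clamp h (memLp_realMode k _)).pow_const 2)

/-- Joint measurability of the spectral dissipation `(t, ω) ↦ ‖∇ traj ω (t ∨ 0)‖₂²`
(`Torus.eGradNormSq_eq_tsum`: a countable sum of squared coefficient moduli). [folklore] -/
theorem measurable_eGradNormSq_clamp (h : Torus.IsStationaryLerayHopfLaw ν f P S traj) :
    Measurable fun p : ℝ × Ω => eGradNormSq (traj p.2 (max p.1 0)) := by
  have heq : (fun p : ℝ × Ω => eGradNormSq (traj p.2 (max p.1 0))) = fun p =>
      ENNReal.ofReal (4 * Real.pi ^ 2) * ∑' k : Fin 3 → ℤ, ENNReal.ofReal (freqNormSq k) *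
        ‖mFourierCoeff (EuclideanSpace.complexify ∘ traj p.2 (max p.1 0)) k‖ₑ ^ 2 :=
    funext fun p => eGradNormSq_eq_tsum _
  rw [heq]
  exact (Measurable.tsum fun k =>
    (measurable_enorm_sq_mFourierCoeff_clamp h k).const_mul _).const_mul _

/-- Joint measurability of the slice energy `(t, ω) ↦ ofReal ‖traj ω (t ∨ 0)‖₂²` (Parseval,
`Torus.tsum_enorm_sq_mFourierCoeff_complexify`). [folklore] -/
theorem measurable_ofReal_normSq_clamp (h : Torus.IsStationaryLerayHopfLaw ν f P S traj) :
    Measurable fun p : ℝ × Ω => ENNReal.ofReal (∫ x, ‖traj p.2 (max p.1 0) x‖ ^ 2) := by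
  have heq : (fun p : ℝ × Ω => ENNReal.ofReal (∫ x, ‖traj p.2 (max p.1 0) x‖ ^ 2)) = fun p =>
      ∑' k : Fin 3 → ℤ, ‖mFourierCoeff (EuclideanSpace.complexify ∘ traj p.2 (max p.1 0)) k‖ₑ ^ 2 := by
    funext p
    have hv := (h.isGlobalLerayHopf p.2).memLp_two (le_max_right p.1 0)
    rw [tsum_enorm_sq_mFourierCoeff_complexify hv, Torus.lintegral_enorm_sq_eq_ofReal hv]
  rw [heq]
  exact Measurable.tsum fun k => measurable_enorm_sq_mFourierCoeff_clamp h k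

/-- The slice energy `ω ↦ ‖traj ω 0‖₂²` is measurable. [folklore] -/
theorem measurable_normSq_zero (h : Torus.IsStationaryLerayHopfLaw ν f P S traj) :
    Measurable fun ω => ∫ x, ‖traj ω 0 x‖ ^ 2 := by
  have h1 : Measurable ((fun p : ℝ × Ω => ENNReal.ofReal (∫ x, ‖traj p.2 (max p.1 0) x‖ ^ 2)) ∘
      fun ω : Ω => ((0 : ℝ), ω)) :=
    (measurable_ofReal_normSq_clamp h).comp measurable_prodMk_left
  simp only [Function.comp_def, max_self] at h1
  have h2 : (fun ω => ∫ x, ‖traj ω 0 x‖ ^ 2) =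
      fun ω => (ENNReal.ofReal (∫ x, ‖traj ω 0 x‖ ^ 2)).toReal :=
    funext fun ω => (ENNReal.toReal_ofReal (integral_nonneg fun x => by positivity)).symm
  rw [h2]
  exact h1.ennreal_toReal

/-- The `ℝ≥0∞` unit-window dissipation `ω ↦ ∫⁻_{(0,1)} ‖∇ traj ω‖₂²` is measurable (Tonelli).
[folklore] -/
theorem measurable_lintegral_eGradNormSq (h : Torus.IsStationaryLerayHopfLaw ν f P S traj) :
    Measurable fun ω => ∫⁻ s in Ioo (0 : ℝ) 1, eGradNormSq (traj ω s) := by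
  have heq : (fun ω => ∫⁻ s in Ioo (0 : ℝ) 1, eGradNormSq (traj ω s)) =
      fun ω => ∫⁻ s in Ioo (0 : ℝ) 1, eGradNormSq (traj ω (max s 0)) := by
    funext ω
    exact setLIntegral_congr_fun measurableSet_Ioo fun s hs => by rw [max_eq_left hs.1.le]
  rw [heq]
  exact (measurable_eGradNormSq_clamp h).lintegral_prod_left'

/-- The Bochner unit-window dissipation `ω ↦ ∫₀¹ ν (‖∇ traj ω‖₂²).toReal` is measurable. [folklore] -/
theorem measurable_windowDissipation (h : Torus.IsStationaryLerayHopfLaw ν f P S traj) :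
    Measurable fun ω => ∫ t in (0 : ℝ)..1, ν * (eGradNormSq (traj ω t)).toReal := by
  have heq : (fun ω => ∫ t in (0 : ℝ)..1, ν * (eGradNormSq (traj ω t)).toReal) =
      fun ω => ν * (∫⁻ s in Ioo (0 : ℝ) 1, eGradNormSq (traj ω s)).toReal :=
    funext fun ω => windowDissipation_eq (h.isGlobalLerayHopf ω)
  rw [heq]
  exact (measurable_lintegral_eGradNormSq h).ennreal_toReal.const_mul ν

/-- The Bochner unit-window energy `ω ↦ ∫₀¹ ‖traj ω‖₂²` is (strongly) measurable (Tonelli for the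
jointly measurable clamped slice energy). [folklore] -/
theorem aestronglyMeasurable_windowEnergy (h : Torus.IsStationaryLerayHopfLaw ν f P S traj) :
    AEStronglyMeasurable (fun ω => ∫ t in (0 : ℝ)..1, ∫ x, ‖traj ω t x‖ ^ 2) P := by
  have hsm : StronglyMeasurable fun p : ℝ × Ω =>
      (ENNReal.ofReal (∫ x, ‖traj p.2 (max p.1 0) x‖ ^ 2)).toReal :=
    (measurable_ofReal_normSq_clamp h).ennreal_toReal.stronglyMeasurable
  have h1 : StronglyMeasurable fun ω =>
      ∫ t in Ioc (0 : ℝ) 1, (ENNReal.ofReal (∫ x, ‖traj ω (max t 0) x‖ ^ 2)).toReal :=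
    hsm.integral_prod_left'
  have heq : (fun ω => ∫ t in (0 : ℝ)..1, ∫ x, ‖traj ω t x‖ ^ 2) =
      fun ω => ∫ t in Ioc (0 : ℝ) 1, (ENNReal.ofReal (∫ x, ‖traj ω (max t 0) x‖ ^ 2)).toReal := by
    funext ω
    rw [intervalIntegral.integral_of_le zero_le_one]
    refine setIntegral_congr_fun measurableSet_Ioc fun t ht => ?_
    rw [max_eq_left ht.1.le, ENNReal.toReal_ofReal (integral_nonneg fun x => by positivity)]
  rw [heq]
  exact h1.aestronglyMeasurable

end Law

end LawRealisation

end Summit.AnomalousDissipation.AnomalousDissipation.Theorems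

end
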